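import Summits.Ventures.YMGap.Census.WindowLinks
import Summits.Ventures.YMGap.Census.RowMerge
import HarnessLib

/-!
# Venture YMGap, track (b) — integrating the interior VERTICAL links of a decimation window:
# the `b` rows of `b` fine plaquettes merge into `b` rectangles `b × 1`

HONEST FRAMING: venture file of the cell `pub-ymgap` (QuantumFields programme), track (b); exact character calculus on
finite tori for the exactness half of Tomboulis's Prop. III.1 (arXiv:0707.2179 §2.1 (RG2)–(RG3)).  Nothing here concerns
(5.15), limits, confinement or a mass gap.

For the window of a coarse plaquette `P` of `(ℤ/L)^d` inside `(ℤ/bL)^d` (`WindowGeometry`), row `t < b` consists of the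
fine plaquettes `(s, t)`, `s < b`, i.e. of the faces `χ(h_{s,t} v_{s+1,t} h_{s,t+1}⁻¹ v_{s,t}⁻¹)` of `RowMerge` with rungs
the vertical links `v_{k,t}` (`rowA`, `rowB`, `rowE`; `faceSum_base_eq_faceW`).  The merge links `v_{k,t}`, `1 ≤ k ≤ b-1`,
are interior links of the window, read by no other row and no other window (`WindowLinks`), so
`RowMerge.integral_prod_faceW_eq_rowState` merges the row into
`Σ_m A_m^b/(m+1)^{b-1} χ_m(H_t v_{b,t} H_{t+1}⁻¹ v_{0,t}⁻¹)`, `H_t = h_{0,t}⋯h_{b-1,t}` (`rowMerged`), in the presence of any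
spectator not reading these links (`integral_rowProd_mul`); doing this for every row (`integral_windowProd_rows`)
leaves the ladder of `b` rectangles.

References: E. T. Tomboulis, arXiv:0707.2179 §2.1 [cite: Tomboulis2007Confinement, §2.1 (RG2)–(RG3)]; A. A. Migdal,
Sov. Phys. JETP 42 (1975) 413 [folklore].
-/

noncomputable section

open MeasureTheory Finset Real Function
open scoped BigOperators
open Literature.MathematicalPhysics.QuantumLattice
open Literature.MathematicalPhysics.QuantumFieldTheory
open Literature.MathematicalPhysics.QuantumFieldTheory.Tomboulis2007
open Summit.Ventures.LatticeQCDFlow.Exactness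
open Summit.Ventures.LatticeQCDFlow.Scoring

namespace Summit.Ventures.YMGap.Census

variable {d L : ℕ} (b : ℕ)

/-! ### Update invariance of row states and faces (pointwise plumbing for `RowMerge`) -/

section Update

variable {N : ℕ}

/-- A face whose data at its own indices do not read the link `E` ignores updates at `E`. -/
theorem faceW_update_at (K : ℕ) (A : ℕ → ℝ) {a c : ℕ → GaugeConfig d N SU2 → SU2} {e : ℕ → Edge d N}
    {r : ℕ → GaugeConfig d N SU2 → SU2} {E : Edge d N} {i : ℕ} (ha : ∀ U g, a i (update U E g) = a i U)
    (hc : ∀ U g, c i (update U E g) = c i U) (hr0 : ∀ U g, r i (update U E g) = r i U)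
    (hr1 : ∀ U g, r (i + 1) (update U E g) = r (i + 1) U) (h1 : e i ≠ E) (h2 : e (i + 1) ≠ E)
    (U : GaugeConfig d N SU2) (g : SU2) : faceW K A a c e r i (update U E g) = faceW K A a c e r i U := by
  simp only [faceW, rungW, ha, hc, hr0, hr1, update_of_ne h1, update_of_ne h2]

/-- `prodA a k` ignores updates at a link that `a_0, …, a_k` do not read. -/
theorem prodA_update_le {a : ℕ → GaugeConfig d N SU2 → SU2} {E : Edge d N} {k : ℕ}
    (ha : ∀ i ≤ k, ∀ U g, a i (update U E g) = a i U) (U : GaugeConfig d N SU2) (g : SU2) :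
    prodA a k (update U E g) = prodA a k U := by
  unfold prodA
  congr 1
  exact List.map_congr_left fun i hi => ha i (Nat.lt_succ_iff.1 (List.mem_range.1 hi)) U g

/-- `prodB c k` ignores updates at a link that `c_0, …, c_k` do not read. -/
theorem prodB_update_le {c : ℕ → GaugeConfig d N SU2 → SU2} {E : Edge d N} {k : ℕ}
    (hc : ∀ i ≤ k, ∀ U g, c i (update U E g) = c i U) (U : GaugeConfig d N SU2) (g : SU2) :
    prodB c k (update U E g) = prodB c k U := by
  unfold prodB
  congr 2
  exact List.map_congr_left fun i hi => hc i (Nat.lt_succ_iff.1 (List.mem_range.1 hi)) U g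

/-- A row state whose data do not read the link `E` ignores updates at `E`. -/
theorem rowState_update_at (K : ℕ) (A : ℕ → ℝ) {a c : ℕ → GaugeConfig d N SU2 → SU2} {e : ℕ → Edge d N}
    {r : ℕ → GaugeConfig d N SU2 → SU2} {E : Edge d N} {k : ℕ} (ha : ∀ i ≤ k, ∀ U g, a i (update U E g) = a i U)
    (hc : ∀ i ≤ k, ∀ U g, c i (update U E g) = c i U) (hr0 : ∀ U g, r 0 (update U E g) = r 0 U)
    (hrk : ∀ U g, r (k + 1) (update U E g) = r (k + 1) U) (h1 : e 0 ≠ E) (h2 : e (k + 1) ≠ E)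
    (U : GaugeConfig d N SU2) (g : SU2) : rowState K A a c e r k (update U E g) = rowState K A a c e r k U := by
  simp only [rowState, rungW, prodA_update_le ha, prodB_update_le hc, hr0, hrk, update_of_ne h1, update_of_ne h2]

end Update

/-! ### The rows of a window as `RowMerge` data -/

/-- Face data `a_s = U(h_{s,t})` of row `t`. -/
def rowA (P : Plaquette d L) (t : ℕ) (s : ℕ) (W : GaugeConfig d (b * L) SU2) : SU2 := W (hLink b P s t)

/-- Face data `b_s = U(h_{s,t+1})⁻¹` of row `t`. -/
def rowB (P : Plaquette d L) (t : ℕ) (s : ℕ) (W : GaugeConfig d (b * L) SU2) : SU2 := (W (hLink b P s (t + 1)))⁻¹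

/-- Rungs `e_k = v_{k,t}` of row `t`. -/
def rowE (P : Plaquette d L) (t : ℕ) (k : ℕ) : Edge d (b * L) := vLink b P k t

/-- Trivial companions. -/
def oneR : ℕ → GaugeConfig d (b * L) SU2 → SU2 := fun _ _ => 1

/-- **A fine plaquette of the window is a `RowMerge` face of its row.** -/
theorem faceSum_base_eq_faceW (K : ℕ) (A : ℕ → ℝ) (P : Plaquette d L) (s t : ℕ) (W : GaugeConfig d (b * L) SU2) :
    faceSum K A (plaquetteHolonomy W (base b P s t) P.2.1.1 P.2.1.2) =
      faceW K A (rowA b P t) (rowB b P t) (rowE b P t) (oneR b) s W := by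
  simp only [faceW, rungW, rowA, rowB, rowE, oneR, mul_one, plaquetteHolonomy_base]

/-- Row `t` of the window of `P`: `∏_{s<b} (face (s,t))`. -/
def rowProd (K : ℕ) (A : ℕ → ℝ) (P : Plaquette d L) (t : ℕ) (W : GaugeConfig d (b * L) SU2) : ℝ :=
  ∏ s ∈ Finset.range b, faceW K A (rowA b P t) (rowB b P t) (rowE b P t) (oneR b) s W

/-- Row `t` after merging its `b` faces: `Σ_m A_m^b/(m+1)^{b-1} χ_m(H_t v_{b,t} H_{t+1}⁻¹ v_{0,t}⁻¹)`. -/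
def rowMerged (K : ℕ) (A : ℕ → ℝ) (P : Plaquette d L) (t : ℕ) (W : GaugeConfig d (b * L) SU2) : ℝ :=
  rowState K A (rowA b P t) (rowB b P t) (rowE b P t) (oneR b) (b - 1) W

/-- The window product `∏_{s,t<b} (face (s,t))` as a product of rows. -/
def windowProd (K : ℕ) (A : ℕ → ℝ) (P : Plaquette d L) (W : GaugeConfig d (b * L) SU2) : ℝ :=
  ∏ t ∈ Finset.range b, rowProd b K A P t W

variable {b}
variable [NeZero b] [NeZero L]

/-! ### Continuity and update invariance -/

omit [NeZero b] [NeZero L] in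
/-- `rowA` is continuous. -/
theorem continuous_rowA (P : Plaquette d L) (t s : ℕ) : Continuous (rowA b P t s) := continuous_apply _

omit [NeZero b] [NeZero L] in
/-- `rowB` is continuous. -/
theorem continuous_rowB (P : Plaquette d L) (t s : ℕ) : Continuous (rowB b P t s) := (continuous_apply _).inv

omit [NeZero b] [NeZero L] in
/-- `oneR` is continuous. -/
theorem continuous_oneR (j : ℕ) : Continuous (oneR (d := d) (L := L) b j) := continuous_const

omit [NeZero b] [NeZero L] in
/-- `rowProd` is continuous. -/
theorem continuous_rowProd (K : ℕ) (A : ℕ → ℝ) (P : Plaquette d L) (t : ℕ) : Continuous (rowProd b K A P t) :=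
  continuous_finsetProd _ fun s _ =>
    continuous_faceW K A (rowE b P t) (continuous_rowA P t) (continuous_rowB P t) continuous_oneR s

omit [NeZero b] [NeZero L] in
/-- `rowMerged` is continuous. -/
theorem continuous_rowMerged (K : ℕ) (A : ℕ → ℝ) (P : Plaquette d L) (t : ℕ) : Continuous (rowMerged b K A P t) := by
  unfold rowMerged rowState
  exact (continuous_faceSum K _).comp
    ((((continuous_prodA (continuous_rowA P t) _).mul (continuous_rungW _ continuous_oneR _)).mul
      (continuous_prodB (continuous_rowB P t) _)).mul (continuous_rungW _ continuous_oneR _).inv)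

omit [NeZero b] [NeZero L] in
/-- `windowProd` is continuous. -/
theorem continuous_windowProd (K : ℕ) (A : ℕ → ℝ) (P : Plaquette d L) : Continuous (windowProd b K A P) :=
  continuous_finsetProd _ fun t _ => continuous_rowProd K A P t

omit [NeZero b] [NeZero L] in
/-- A row product ignores updates at a link that is none of the links it reads
(`h_{s,t}`, `h_{s,t+1}` for `s < b`, `v_{s',t}` for `s' ≤ b`). -/
theorem rowProd_update (K : ℕ) (A : ℕ → ℝ) (P : Plaquette d L) (t : ℕ) {E : Edge d (b * L)}
    (hh0 : ∀ s, s < b → hLink b P s t ≠ E) (hh1 : ∀ s, s < b → hLink b P s (t + 1) ≠ E)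
    (hv : ∀ s', s' ≤ b → vLink b P s' t ≠ E) (W : GaugeConfig d (b * L) SU2) (g : SU2) :
    rowProd b K A P t (update W E g) = rowProd b K A P t W := by
  refine Finset.prod_congr rfl fun s hs => ?_
  have hsb := Finset.mem_range.1 hs
  exact faceW_update_at K A (e := rowE b P t) (r := oneR b) (fun U g' => update_of_ne (hh0 s hsb) _ _)
    (fun U g' => by simp only [rowB, update_of_ne (hh1 s hsb)]) (fun _ _ => rfl) (fun _ _ => rfl)
    (hv s hsb.le) (hv (s + 1) (by omega)) W g

omit [NeZero L] in
/-- A merged row ignores updates at a link that is none of the links it reads. -/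
theorem rowMerged_update (K : ℕ) (A : ℕ → ℝ) (P : Plaquette d L) (t : ℕ) {E : Edge d (b * L)}
    (hh0 : ∀ s, s < b → hLink b P s t ≠ E) (hh1 : ∀ s, s < b → hLink b P s (t + 1) ≠ E)
    (hv : ∀ s', s' ≤ b → vLink b P s' t ≠ E) (W : GaugeConfig d (b * L) SU2) (g : SU2) :
    rowMerged b K A P t (update W E g) = rowMerged b K A P t W := by
  have hb : b - 1 + 1 = b := Nat.sub_add_cancel (Nat.one_le_iff_ne_zero.2 (NeZero.ne b))
  refine rowState_update_at K A (e := rowE b P t) (r := oneR b) (fun i hi U g' => update_of_ne (hh0 i (by omega)) _ _)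
    (fun i hi U g' => by simp only [rowB, update_of_ne (hh1 i (by omega))]) (fun _ _ => rfl) (fun _ _ => rfl)
    (hv 0 (Nat.zero_le _)) ?_ W g
  simp only [rowE, hb]
  exact hv b le_rfl

/-! ### Merging one row -/

omit [NeZero L] in
/-- Rungs of a row are pairwise distinct where it matters: `v_{j,t} ≠ v_{k,t}` for `j ≤ b`, `1 ≤ k < b`, `j ≠ k`. -/
theorem rowE_ne (P : Plaquette d L) (t : ℕ) {j k : ℕ} (hj : j ≤ b) (hk1 : 1 ≤ k) (hkb : k < b) (hjk : j ≠ k) :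
    rowE b P t j ≠ rowE b P t k := by
  refine vLink_ne_vLink_of_mod_ne P t t fun h => hjk (eq_of_mod_eq_of_interior hj hk1 hkb h)

/-- **Merging row `t`**: in the presence of a continuous spectator `S` not reading the interior vertical links
`v_{k,t}` (`1 ≤ k < b`), `∫ rowProd_t · S = ∫ rowMerged_t · S`. -/
theorem integral_rowProd_mul (K : ℕ) (A : ℕ → ℝ) (P : Plaquette d L) (t : ℕ) {S : GaugeConfig d (b * L) SU2 → ℝ}
    (hS : ∀ k, 1 ≤ k → k < b → ∀ W g, S (update W (vLink b P k t) g) = S W) (hSc : Continuous S) :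
    ∫ W, rowProd b K A P t W * S W ∂(Measure.pi fun _ : Edge d (b * L) => haarProbability SU2) =
      ∫ W, rowMerged b K A P t W * S W ∂(Measure.pi fun _ : Edge d (b * L) => haarProbability SU2) := by
  have hb : 1 ≤ b := Nat.one_le_iff_ne_zero.2 (NeZero.ne b)
  unfold rowProd rowMerged
  refine integral_prod_faceW_eq_rowState K A hb ?_ ?_ ?_ ?_ ?_ (continuous_rowA P t) (continuous_rowB P t)
    continuous_oneR hSc
  · intro k _ _ i U g
    exact update_of_ne (hLink_ne_vLink P i t k t) _ _
  · intro k _ _ i U g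
    simp only [rowB, rowE, update_of_ne (hLink_ne_vLink P i (t + 1) k t)]
  · intro k _ _ j U g
    rfl
  · intro k hk1 hkb U g
    exact hS k hk1 (by omega) U g
  · intro k hk1 hkb j hj hjk
    exact rowE_ne P t hj hk1 (by omega) hjk

/-- The spectator of row `t` while the rows in `T` are merged and the others not (bookkeeping). -/
def rowSpec (K : ℕ) (A : ℕ → ℝ) (P : Plaquette d L) (T : Finset ℕ) (t : ℕ) (Q : GaugeConfig d (b * L) SU2 → ℝ)
    (W : GaugeConfig d (b * L) SU2) : ℝ :=
  (∏ t' ∈ T, rowMerged b K A P t' W) * (∏ t' ∈ (Finset.range b \ T).erase t, rowProd b K A P t' W) * Q W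

omit [NeZero b] [NeZero L] in
/-- `rowSpec` is continuous for continuous `Q`. -/
theorem continuous_rowSpec (K : ℕ) (A : ℕ → ℝ) (P : Plaquette d L) (T : Finset ℕ) (t : ℕ)
    {Q : GaugeConfig d (b * L) SU2 → ℝ} (hQc : Continuous Q) : Continuous (rowSpec K A P T t Q) :=
  ((continuous_finsetProd _ fun t' _ => continuous_rowMerged K A P t').mul
    (continuous_finsetProd _ fun t' _ => continuous_rowProd K A P t')).mul hQc

/-- `rowSpec` does not read the interior vertical links of row `t` (`t ∉ T ⊆ range b`). -/
theorem rowSpec_update (K : ℕ) (A : ℕ → ℝ) (P : Plaquette d L) {T : Finset ℕ} {t : ℕ} (hTb : T ⊆ Finset.range b)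
    (ht : t ∉ T) (htb : t < b) {Q : GaugeConfig d (b * L) SU2 → ℝ}
    (hQ : ∀ k t, 1 ≤ k → k < b → t < b → ∀ W g, Q (update W (vLink b P k t) g) = Q W)
    {k : ℕ} (hk1 : 1 ≤ k) (hkb : k < b) (W : GaugeConfig d (b * L) SU2) (g : SU2) :
    rowSpec K A P T t Q (update W (vLink b P k t) g) = rowSpec K A P T t Q W := by
  have hv : ∀ t' ≠ t, t' < b → ∀ j, j ≤ b → vLink b P j t' ≠ vLink b P k t := fun t' ht't ht'b j _ =>
    vLink_ne_vLink_of_snd_ne P ht'b htb ht't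
  have h1 : ∏ t' ∈ T, rowMerged b K A P t' (update W (vLink b P k t) g) = ∏ t' ∈ T, rowMerged b K A P t' W := by
    refine Finset.prod_congr rfl fun t' ht' => ?_
    exact rowMerged_update K A P t' (fun s _ => hLink_ne_vLink P s t' k t) (fun s _ => hLink_ne_vLink P s _ k t)
      (hv t' (fun h => ht (h ▸ ht')) (Finset.mem_range.1 (hTb ht'))) W g
  have h2 : ∏ t' ∈ (Finset.range b \ T).erase t, rowProd b K A P t' (update W (vLink b P k t) g) =
      ∏ t' ∈ (Finset.range b \ T).erase t, rowProd b K A P t' W := by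
    refine Finset.prod_congr rfl fun t' ht' => ?_
    have ht'2 := Finset.mem_erase.1 ht'
    exact rowProd_update K A P t' (fun s _ => hLink_ne_vLink P s t' k t) (fun s _ => hLink_ne_vLink P s _ k t)
      (hv t' ht'2.1 (Finset.mem_range.1 (Finset.mem_sdiff.1 ht'2.2).1)) W g
  unfold rowSpec
  rw [h1, h2, hQ k t hk1 hkb htb]

omit [NeZero b] [NeZero L] in
/-- Isolating row `t` before merging it (bookkeeping). -/
theorem rowSpec_before (K : ℕ) (A : ℕ → ℝ) (P : Plaquette d L) {T : Finset ℕ} {t : ℕ} (ht : t ∉ T) (htb : t < b)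
    (Q : GaugeConfig d (b * L) SU2 → ℝ) (W : GaugeConfig d (b * L) SU2) :
    (∏ t' ∈ T, rowMerged b K A P t' W) * (∏ t' ∈ Finset.range b \ T, rowProd b K A P t' W) * Q W =
      rowProd b K A P t W * rowSpec K A P T t Q W := by
  have hmem : t ∈ Finset.range b \ T := Finset.mem_sdiff.2 ⟨Finset.mem_range.2 htb, ht⟩
  unfold rowSpec
  rw [← Finset.mul_prod_erase _ _ hmem]
  ring

omit [NeZero b] [NeZero L] in
/-- Row `t` after merging it (bookkeeping). -/
theorem rowSpec_after (K : ℕ) (A : ℕ → ℝ) (P : Plaquette d L) {T : Finset ℕ} {t : ℕ} (ht : t ∉ T)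
    (Q : GaugeConfig d (b * L) SU2 → ℝ) (W : GaugeConfig d (b * L) SU2) :
    (∏ t' ∈ insert t T, rowMerged b K A P t' W) * (∏ t' ∈ Finset.range b \ insert t T, rowProd b K A P t' W) * Q W =
      rowMerged b K A P t W * rowSpec K A P T t Q W := by
  have hsd : Finset.range b \ insert t T = (Finset.range b \ T).erase t := by
    ext x
    simp only [Finset.mem_sdiff, Finset.mem_insert, Finset.mem_erase, not_or]
    tauto
  unfold rowSpec
  rw [Finset.prod_insert ht, hsd]
  ring

/-- **Merging every row of the window** (spectator `Q` not reading any interior vertical link):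
`∫ (∏_t rowProd_t) · Q = ∫ (∏_t rowMerged_t) · Q`. -/
theorem integral_windowProd_rows (K : ℕ) (A : ℕ → ℝ) (P : Plaquette d L) {Q : GaugeConfig d (b * L) SU2 → ℝ}
    (hQ : ∀ k t, 1 ≤ k → k < b → t < b → ∀ W g, Q (update W (vLink b P k t) g) = Q W) (hQc : Continuous Q) :
    ∫ W, windowProd b K A P W * Q W ∂(Measure.pi fun _ : Edge d (b * L) => haarProbability SU2) =
      ∫ W, (∏ t ∈ Finset.range b, rowMerged b K A P t W) * Q W
        ∂(Measure.pi fun _ : Edge d (b * L) => haarProbability SU2) := by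
  -- induction over the set `T` of merged rows
  suffices h : ∀ T : Finset ℕ, T ⊆ Finset.range b →
      ∫ W, windowProd b K A P W * Q W ∂(Measure.pi fun _ : Edge d (b * L) => haarProbability SU2) =
        ∫ W, (∏ t ∈ T, rowMerged b K A P t W) * (∏ t ∈ Finset.range b \ T, rowProd b K A P t W) * Q W
          ∂(Measure.pi fun _ : Edge d (b * L) => haarProbability SU2) by
    rw [h (Finset.range b) subset_rfl]
    simp only [Finset.sdiff_self, Finset.prod_empty, mul_one]
  intro T hT
  induction T using Finset.induction_on with
  | empty =>
    simp only [Finset.prod_empty, Finset.sdiff_empty, one_mul]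
    rfl
  | insert t T ht ih =>
    have htb : t < b := Finset.mem_range.1 (hT (Finset.mem_insert_self t T))
    have hTb : T ⊆ Finset.range b := fun x hx => hT (Finset.mem_insert_of_mem hx)
    rw [ih hTb]
    simp_rw [rowSpec_before K A P ht htb Q, rowSpec_after K A P ht Q]
    exact integral_rowProd_mul K A P t (fun k hk1 hkb W g => rowSpec_update K A P hTb ht htb hQ hk1 hkb W g)
      (continuous_rowSpec K A P T t hQc)

end Summit.Ventures.YMGap.Census

end
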